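import Summits.Ventures.Crystal3D.Theorems.StickyWulffConstantNoReconstructionGainGrainFrameBudgetTwo
import HarnessLib

/-!
# The cap budget of a moved fcc bond star below height `√(2/11)`: three steep directions

HONEST FRAMING. Part of the venture `Summits/Ventures/Crystal3D` (cell `crystal3d-full`), helper
`--supports` the crux `NoReconstructionGain` (stmt-Ventures-19144, route
`route-Ventures-StickyWulffConstant`), line `adhesion` (wulff-p1 g11).  Third brick of the open stub
`stub_frameCapBudget`: the STEEP HALF of the three-contact case.

* `third_depth_ge` — in sorted cubic coordinates `0 ≤ a ≤ b ≤ c`, `a² + b² + c² = 2`, the third-deepest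
  star depth `max(a+b, c−a)/2` is at least `√(2/11)` (sharp at the normal `(1,1,3)/√11`).
* `frameCapBudget_of_le_sqrt_two_elevenths` (**rung**, registered by name on stmt-Ventures-19144) — for
  `0 < t ≤ √(2/11)` the cap budget holds for every `K` with `#K ≤ 3`, every rotation, every normal:
  the three deepest moved star directions `A t, A v` and `A u` or `A (t − u)` are steep.  So a grain film
  whose substrate-touching balls all lie within height `√(2/11) ≈ 0.426` above the cut gains nothing; what
  remains of the cap budget is three contacts ABOVE that height (pure blocking lemma PBL3, lead memo
  CAPBUDGET-g11.md §5a).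

WHAT THIS IS NOT: the three-contact budget above height `√(2/11)`; rung F-C1 not moved.
-/

noncomputable section

namespace Summit.Ventures.Crystal3D.Theorems

open Summit.Ventures.Crystal3D Finset
open Literature.MathematicalPhysics.StatisticalMechanics (fccStacking barlowPos constHagg barlowPos_mem)
open scoped InnerProductSpace

/-- **The third star depth is at least `√(2/11)`.** -/
theorem third_depth_ge {a b c : ℝ} (ha : 0 ≤ a) (hab : a ≤ b) (hbc : b ≤ c)
    (hS : a ^ 2 + b ^ 2 + c ^ 2 = 2) : Real.sqrt (2 / 11) ≤ max (a + b) (c - a) / 2 := by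
  have hm : Real.sqrt (2 / 11) ^ 2 = 2 / 11 := Real.sq_sqrt (by norm_num)
  have hm0 : 0 ≤ Real.sqrt (2 / 11) := Real.sqrt_nonneg _
  by_contra h; push Not at h
  have h1 : a + b < 2 * Real.sqrt (2 / 11) := by linarith [le_max_left (a + b) (c - a)]
  have h2 : c - a < 2 * Real.sqrt (2 / 11) := by linarith [le_max_right (a + b) (c - a)]
  have h3 : a < Real.sqrt (2 / 11) := by linarith
  nlinarith [mul_nonneg ha (le_trans ha hab)]

/-- Three distinct members of `U` with a property give `3 ≤ #filter`. -/
theorem three_le_card_filter_of_triple {U : Finset (EuclideanSpace ℝ (Fin 3))}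
    {P : EuclideanSpace ℝ (Fin 3) → Prop} [DecidablePred P] {d d' d'' : EuclideanSpace ℝ (Fin 3)}
    (hd : d ∈ U) (hd' : d' ∈ U) (hd'' : d'' ∈ U) (h1 : d ≠ d') (h2 : d ≠ d'') (h3 : d' ≠ d'')
    (hP : P d) (hP' : P d') (hP'' : P d'') : 3 ≤ (U.filter P).card := by
  classical
  have hsub : ({d, d', d''} : Finset (EuclideanSpace ℝ (Fin 3))) ⊆ U.filter P := by
    intro e he
    simp only [mem_insert, mem_singleton] at he
    rcases he with rfl | rfl | rfl
    · exact mem_filter.2 ⟨hd, hP⟩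
    · exact mem_filter.2 ⟨hd', hP'⟩
    · exact mem_filter.2 ⟨hd'', hP''⟩
  have := card_le_card hsub
  have hc : ({d, d', d''} : Finset (EuclideanSpace ℝ (Fin 3))).card = 3 := by
    rw [card_insert_of_notMem (by simp [h1, h2]), card_pair h3]
  omega

set_option maxHeartbeats 400000 in
/-- The steep half for three contacts, sorted pole: if `t ≤ √(2/11)` then three moved star directions
are steep. -/
theorem frameCapBudget_low_sorted (U₀ : Finset (EuclideanSpace ℝ (Fin 3)))
    (hU₀ : ∀ d ∈ U₀, d ∈ fccStacking 1 (Real.sqrt (2 / 3)) ∧ ‖d‖ = 1) (hU₀card : U₀.card = 12)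
    (A : EuclideanSpace ℝ (Fin 3) ≃ₗᵢ[ℝ] EuclideanSpace ℝ (Fin 3))
    (ν : EuclideanSpace ℝ (Fin 3)) (hν : ‖ν‖ = 1) (t : ℝ) (ht : 0 < t) (htm : t ≤ Real.sqrt (2 / 11))
    (K : Finset (EuclideanSpace ℝ (Fin 3)))
    (hsort : 0 ≤ (A.symm (-ν)) 0 + Real.sqrt 3 / 3 * (A.symm (-ν)) 1 - Real.sqrt (2 / 3) * (A.symm (-ν)) 2 ∧
      (A.symm (-ν)) 0 + Real.sqrt 3 / 3 * (A.symm (-ν)) 1 - Real.sqrt (2 / 3) * (A.symm (-ν)) 2 ≤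
        (A.symm (-ν)) 0 - Real.sqrt 3 / 3 * (A.symm (-ν)) 1 + Real.sqrt (2 / 3) * (A.symm (-ν)) 2 ∧
      (A.symm (-ν)) 0 - Real.sqrt 3 / 3 * (A.symm (-ν)) 1 + Real.sqrt (2 / 3) * (A.symm (-ν)) 2 ≤
        2 * Real.sqrt 3 / 3 * (A.symm (-ν)) 1 + Real.sqrt (2 / 3) * (A.symm (-ν)) 2) :
    (3 : ℝ) ≤
      (((U₀.image fun d => A d).filter fun d =>
          ⟪d, ν⟫_ℝ < 0 ∧ ((∃ u ∈ K, 1 / 2 < ⟪u, d⟫_ℝ) ∨ ⟪d, ν⟫_ℝ ≤ -t)).card : ℝ) := by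
  classical
  set S := A.symm (-ν) with hSdef
  set a := S 0 + Real.sqrt 3 / 3 * S 1 - Real.sqrt (2 / 3) * S 2 with hadef
  set b := S 0 - Real.sqrt 3 / 3 * S 1 + Real.sqrt (2 / 3) * S 2 with hbdef
  set c := 2 * Real.sqrt 3 / 3 * S 1 + Real.sqrt (2 / 3) * S 2 with hcdef
  obtain ⟨ha, hab, hbc⟩ := hsort
  have hSn : ‖S‖ = 1 := by rw [hSdef, LinearIsometryEquiv.norm_map, norm_neg, hν]
  have hS2 : a ^ 2 + b ^ 2 + c ^ 2 = 2 := by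
    have h := cubic_inner S S
    rw [real_inner_self_eq_norm_sq, hSn] at h
    rw [hadef, hbdef, hcdef]; nlinarith [h]
  have hνS : ∀ w : EuclideanSpace ℝ (Fin 3), ⟪A w, ν⟫_ℝ = -⟪w, S⟫_ℝ := by
    intro w
    have : ⟪w, S⟫_ℝ = -⟪A w, ν⟫_ℝ := by
      rw [hSdef, ← A.inner_map_map, LinearIsometryEquiv.apply_symm_apply, inner_neg_right]
    linarith
  have e_tu : barlowPos 1 (Real.sqrt (2 / 3)) constHagg 1 (-1) 0 = barlowPos 1 (Real.sqrt (2 / 3)) constHagg 1 0 0 - barlowPos 1 (Real.sqrt (2 / 3)) constHagg 0 1 0 := by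
    rw [barlowPos_fcc_sub]; norm_num
  have m_t := movedStar_mem_of_coords U₀ hU₀ hU₀card A (k := 1) (i := 0) (j := 0) (by norm_num)
  have m_v := movedStar_mem_of_coords U₀ hU₀ hU₀card A (k := 0) (i := 0) (j := 1) (by norm_num)
  have m_u := movedStar_mem_of_coords U₀ hU₀ hU₀card A (k := 0) (i := 1) (j := 0) (by norm_num)
  have m_tu := movedStar_mem_of_coords U₀ hU₀ hU₀card A (k := 1) (i := -1) (j := 0) (by norm_num)
  have ne : ∀ {k i j k' i' j' : ℤ}, (k, i, j) ≠ (k', i', j') → barlowPos 1 (Real.sqrt (2 / 3)) constHagg k i j ≠ barlowPos 1 (Real.sqrt (2 / 3)) constHagg k' i' j' :=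
    fun hne h => hne (barlowPos_fcc_injective h)
  obtain ⟨su, sv, st⟩ := inner_bonds_cubic S
  rw [← hadef, ← hbdef] at su
  rw [← hadef, ← hcdef] at sv
  rw [← hbdef, ← hcdef] at st
  have s_tu : ⟪barlowPos 1 (Real.sqrt (2 / 3)) constHagg 1 (-1) 0, S⟫_ℝ = (c - a) / 2 := by rw [e_tu, inner_sub_left, st, su]; ring
  have nt : ⟪A (barlowPos 1 (Real.sqrt (2 / 3)) constHagg 1 0 0), ν⟫_ℝ = -((b + c) / 2) := by rw [hνS, st]
  have nv : ⟪A (barlowPos 1 (Real.sqrt (2 / 3)) constHagg 0 0 1), ν⟫_ℝ = -((a + c) / 2) := by rw [hνS, sv]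
  have nu : ⟪A (barlowPos 1 (Real.sqrt (2 / 3)) constHagg 0 1 0), ν⟫_ℝ = -((a + b) / 2) := by rw [hνS, su]
  have ntu : ⟪A (barlowPos 1 (Real.sqrt (2 / 3)) constHagg 1 (-1) 0), ν⟫_ℝ = -((c - a) / 2) := by rw [hνS, s_tu]
  have h3rd := third_depth_ge ha hab hbc hS2
  have d_tv : barlowPos 1 (Real.sqrt (2 / 3)) constHagg 1 0 0 ≠ barlowPos 1 (Real.sqrt (2 / 3)) constHagg 0 0 1 := ne (by decide)
  have d_tu' : barlowPos 1 (Real.sqrt (2 / 3)) constHagg 1 0 0 ≠ barlowPos 1 (Real.sqrt (2 / 3)) constHagg 0 1 0 := ne (by decide)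
  have d_vu : barlowPos 1 (Real.sqrt (2 / 3)) constHagg 0 0 1 ≠ barlowPos 1 (Real.sqrt (2 / 3)) constHagg 0 1 0 := ne (by decide)
  have d_ttu : barlowPos 1 (Real.sqrt (2 / 3)) constHagg 1 0 0 ≠ barlowPos 1 (Real.sqrt (2 / 3)) constHagg 1 (-1) 0 := ne (by decide)
  have d_vtu : barlowPos 1 (Real.sqrt (2 / 3)) constHagg 0 0 1 ≠ barlowPos 1 (Real.sqrt (2 / 3)) constHagg 1 (-1) 0 := ne (by decide)
  -- steepness of `A t` and `A v`
  have hmax : max (a + b) (c - a) ≤ a + c := max_le (by linarith) (by linarith)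
  have Pt : ⟪A (barlowPos 1 (Real.sqrt (2 / 3)) constHagg 1 0 0), ν⟫_ℝ < 0 ∧ ((∃ u ∈ K, 1 / 2 < ⟪u, A (barlowPos 1 (Real.sqrt (2 / 3)) constHagg 1 0 0)⟫_ℝ) ∨ ⟪A (barlowPos 1 (Real.sqrt (2 / 3)) constHagg 1 0 0), ν⟫_ℝ ≤ -t) :=
    ⟨by rw [nt]; linarith, Or.inr (by rw [nt]; linarith)⟩
  have Pv : ⟪A (barlowPos 1 (Real.sqrt (2 / 3)) constHagg 0 0 1), ν⟫_ℝ < 0 ∧ ((∃ u ∈ K, 1 / 2 < ⟪u, A (barlowPos 1 (Real.sqrt (2 / 3)) constHagg 0 0 1)⟫_ℝ) ∨ ⟪A (barlowPos 1 (Real.sqrt (2 / 3)) constHagg 0 0 1), ν⟫_ℝ ≤ -t) :=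
    ⟨by rw [nv]; linarith, Or.inr (by rw [nv]; linarith)⟩
  rcases le_total (c - a) (a + b) with h | h
  · -- third steep direction: `A u`
    rw [max_eq_left h] at h3rd
    have Pu : ⟪A (barlowPos 1 (Real.sqrt (2 / 3)) constHagg 0 1 0), ν⟫_ℝ < 0 ∧ ((∃ u ∈ K, 1 / 2 < ⟪u, A (barlowPos 1 (Real.sqrt (2 / 3)) constHagg 0 1 0)⟫_ℝ) ∨ ⟪A (barlowPos 1 (Real.sqrt (2 / 3)) constHagg 0 1 0), ν⟫_ℝ ≤ -t) :=
      ⟨by rw [nu]; linarith, Or.inr (by rw [nu]; linarith)⟩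
    have hc := three_le_card_filter_of_triple m_t m_v m_u (fun e => d_tv (A.injective e))
      (fun e => d_tu' (A.injective e)) (fun e => d_vu (A.injective e))
      (P := fun d => ⟪d, ν⟫_ℝ < 0 ∧ ((∃ u ∈ K, 1 / 2 < ⟪u, d⟫_ℝ) ∨ ⟪d, ν⟫_ℝ ≤ -t)) Pt Pv Pu
    exact_mod_cast hc
  · -- third steep direction: `A (t − u)`
    rw [max_eq_right h] at h3rd
    have Ptu : ⟪A (barlowPos 1 (Real.sqrt (2 / 3)) constHagg 1 (-1) 0), ν⟫_ℝ < 0 ∧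
        ((∃ u ∈ K, 1 / 2 < ⟪u, A (barlowPos 1 (Real.sqrt (2 / 3)) constHagg 1 (-1) 0)⟫_ℝ) ∨ ⟪A (barlowPos 1 (Real.sqrt (2 / 3)) constHagg 1 (-1) 0), ν⟫_ℝ ≤ -t) :=
      ⟨by rw [ntu]; linarith, Or.inr (by rw [ntu]; linarith)⟩
    have hc := three_le_card_filter_of_triple m_t m_v m_tu (fun e => d_tv (A.injective e))
      (fun e => d_ttu (A.injective e)) (fun e => d_vtu (A.injective e))
      (P := fun d => ⟪d, ν⟫_ℝ < 0 ∧ ((∃ u ∈ K, 1 / 2 < ⟪u, d⟫_ℝ) ∨ ⟪d, ν⟫_ℝ ≤ -t)) Pt Pv Ptu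
    exact_mod_cast hc

/-- **RUNG (registered by name on stmt-Ventures-19144): the cap budget below height `√(2/11)`, up to
three contacts.** -/
theorem frameCapBudget_of_le_sqrt_two_elevenths :
    ∀ U₀ : Finset (EuclideanSpace ℝ (Fin 3)),
      (∀ d ∈ U₀, d ∈ fccStacking 1 (Real.sqrt (2 / 3)) ∧ ‖d‖ = 1) → (∀ d ∈ U₀, -d ∈ U₀) → U₀.card = 12 →
      ∀ A : EuclideanSpace ℝ (Fin 3) ≃ₗᵢ[ℝ] EuclideanSpace ℝ (Fin 3),
      ∀ ν : EuclideanSpace ℝ (Fin 3), ‖ν‖ = 1 → ∀ t : ℝ, 0 < t → t ≤ Real.sqrt (2 / 11) →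
        ∀ K : Finset (EuclideanSpace ℝ (Fin 3)), K.card ≤ 3 →
        (∀ u ∈ K, ‖u‖ = 1 ∧ ⟪u, ν⟫_ℝ ≤ -t) → (∀ u ∈ K, ∀ u' ∈ K, u ≠ u' → ⟪u, u'⟫_ℝ ≤ 1 / 2) →
        (K.card : ℝ) ≤
          (((U₀.image fun d => A d).filter fun d =>
              ⟪d, ν⟫_ℝ < 0 ∧ ((∃ u ∈ K, 1 / 2 < ⟪u, d⟫_ℝ) ∨ ⟪d, ν⟫_ℝ ≤ -t)).card : ℝ)
            + (1 / 2) * (((U₀.image fun d => A d).filter fun d =>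
              ⟪d, ν⟫_ℝ = 0 ∧ ∃ u ∈ K, 1 / 2 < ⟪u, d⟫_ℝ).card : ℝ) := by
  classical
  intro U₀ hU₀ _ hU₀card A ν hν t ht htm K hK _ _
  have hnn : (0 : ℝ) ≤ (((U₀.image fun d => A d).filter fun d =>
      ⟪d, ν⟫_ℝ = 0 ∧ ∃ u ∈ K, 1 / 2 < ⟪u, d⟫_ℝ).card : ℝ) := Nat.cast_nonneg _
  have hK3 : (K.card : ℝ) ≤ 3 := by exact_mod_cast hK
  -- chamber
  obtain ⟨fA, hfA⟩ : ∃ f : EuclideanSpace ℝ (Fin 3) → ℝ,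
      ∀ x, f x = x 0 + Real.sqrt 3 / 3 * x 1 - Real.sqrt (2 / 3) * x 2 := ⟨_, fun x => rfl⟩
  obtain ⟨fB, hfB⟩ : ∃ f : EuclideanSpace ℝ (Fin 3) → ℝ,
      ∀ x, f x = x 0 - Real.sqrt 3 / 3 * x 1 + Real.sqrt (2 / 3) * x 2 := ⟨_, fun x => rfl⟩
  obtain ⟨fC, hfC⟩ : ∃ f : EuclideanSpace ℝ (Fin 3) → ℝ,
      ∀ x, f x = 2 * Real.sqrt 3 / 3 * x 1 + Real.sqrt (2 / 3) * x 2 := ⟨_, fun x => rfl⟩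
  obtain ⟨g, hG, h1, h2, h3⟩ := exists_latticeIsometry_cubic_sorted_nonneg fA fB fC hfA hfB hfC (A.symm (-ν))
  set A' : EuclideanSpace ℝ (Fin 3) ≃ₗᵢ[ℝ] EuclideanSpace ℝ (Fin 3) := g.symm.trans A with hA'
  have hA'symm : A'.symm (-ν) = g (A.symm (-ν)) := by rw [hA']; rfl
  have hUeq : (U₀.image fun d => A d) = U₀.image fun d => A' d := by
    ext d
    simp only [mem_image]
    constructor
    · rintro ⟨d₀, hd₀, rfl⟩
      refine ⟨g d₀, fcc_unit_mem_of_bondStar U₀ hU₀ hU₀card (hG.1 d₀ (hU₀ d₀ hd₀).1)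
        (by rw [LinearIsometryEquiv.norm_map]; exact (hU₀ d₀ hd₀).2), ?_⟩
      rw [hA', LinearIsometryEquiv.trans_apply, LinearIsometryEquiv.symm_apply_apply]
    · rintro ⟨d₀, hd₀, rfl⟩
      refine ⟨g.symm d₀, fcc_unit_mem_of_bondStar U₀ hU₀ hU₀card (hG.2 d₀ (hU₀ d₀ hd₀).1)
        (by rw [LinearIsometryEquiv.norm_map]; exact (hU₀ d₀ hd₀).2), ?_⟩
      rw [hA', LinearIsometryEquiv.trans_apply]
  rw [hUeq]
  have hsort : 0 ≤ (A'.symm (-ν)) 0 + Real.sqrt 3 / 3 * (A'.symm (-ν)) 1 - Real.sqrt (2 / 3) * (A'.symm (-ν)) 2 ∧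
      (A'.symm (-ν)) 0 + Real.sqrt 3 / 3 * (A'.symm (-ν)) 1 - Real.sqrt (2 / 3) * (A'.symm (-ν)) 2 ≤
        (A'.symm (-ν)) 0 - Real.sqrt 3 / 3 * (A'.symm (-ν)) 1 + Real.sqrt (2 / 3) * (A'.symm (-ν)) 2 ∧
      (A'.symm (-ν)) 0 - Real.sqrt 3 / 3 * (A'.symm (-ν)) 1 + Real.sqrt (2 / 3) * (A'.symm (-ν)) 2 ≤
        2 * Real.sqrt 3 / 3 * (A'.symm (-ν)) 1 + Real.sqrt (2 / 3) * (A'.symm (-ν)) 2 := by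
    rw [hA'symm, ← hfA, ← hfB, ← hfC]; exact ⟨h1, h2, h3⟩
  have h := frameCapBudget_low_sorted U₀ hU₀ hU₀card A' ν hν t ht htm K hsort
  linarith

end Summit.Ventures.Crystal3D.Theorems

end
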